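import Summits.Ventures.PercRepro.PuncturedLYMSparsePavingGen
import Summits.Ventures.PercRepro.PuncturedLYMFewWords

/-!
# PercRepro — (SP) BY SUPERPOSITION, PART 8: THE SHARPER ERROR BOUND AND THE ROW `n = 3j − 2` (p10, gen 31)

A code word has no neighbour at distance `j − 1`, so the profile bound for the error of a word loses its top class:
`N'(B) ≤ j/(n − j + 1) − (1 − τ)/(n − j − 1)` (`sum_eDef_le_of_no_near`).  Hence `(n − j)·totalW ≥
1 − 2j/(n − j + 1) + (1 − τ)/(n − j − 1)`, which is `≥ 0` also at `n = 3j − 2` for `j ≥ 3` (`τ·(2j − 1) ≤ 2`, since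
`C(3j − 2, j + 1) ≥ C(3j − 2, 2)`): THEOREM A at `3j ≤ n + 2` — the regime of the paper proof.
* `choose_two_le_choose` — `C(m, 2) ≤ C(m, k)` for `2 ≤ k ≤ m − 2`;
* `sum_eDef_le_of_no_near` — the profile bound without the top class;
* **`puncturedNMP_of_three_j'`** — (SP) for every code with `3 ≤ j`, `2j + 1 ≤ n`, `3j ≤ n + 2`;
* `puncturedNMP_in_of_three_j'`, **`normConsAt_of_sparsePaving''`** — the same inside any finset, and (NC) for every
  sparse paving matroid with `r + 1 ≤ n`, `n + 2 ≤ 2r`, `3(n − r) ≤ n + 2` (`n ≤ (3r + 2)/2`, `n − r ≥ 3`).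
Nothing here asserts (SP) or (NC) in general.
-/

open scoped Matroid

namespace PercRepro.PuncturedLYM

open Finset

variable {α : Type} [Fintype α] [DecidableEq α]

/-! ### `C(m, 2) ≤ C(m, k)` for `2 ≤ k ≤ m − 2` -/

/-- `C(m, 2) ≤ C(m, k)` for `2 ≤ k ≤ m − 2`. -/
theorem choose_two_le_choose (m k : ℕ) (hk2 : 2 ≤ k) (hkm : k + 2 ≤ m) : m.choose 2 ≤ m.choose k := by
  induction m generalizing k with
  | zero => omega
  | succ m ih =>
    rcases Nat.eq_or_lt_of_le hk2 with h2 | h2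
    · rw [← h2]
    rcases Nat.eq_or_lt_of_le hkm with hm | hm
    · -- `k = m − 1`: `C(m+1, m−1) = C(m+1, 2)`
      have : k = m + 1 - 2 := by omega
      rw [this, Nat.choose_symm (by omega)]
    · -- `3 ≤ k ≤ m − 2`: both terms of Pascal's rule are `≥ C(m, 2)`, and `C(m+1, 2) = C(m, 2) + m ≤ 2·C(m, 2)`
      obtain ⟨k', rfl⟩ : ∃ k', k = k' + 1 := ⟨k - 1, by omega⟩
      rw [show (m + 1).choose (k' + 1) = m.choose k' + m.choose (k' + 1) from Nat.choose_succ_succ' m k']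
      have hA := ih k' (by omega) (by omega)
      have hB := ih (k' + 1) (by omega) (by omega)
      have hP : (m + 1).choose 2 = m.choose 1 + m.choose 2 := Nat.choose_succ_succ' m 1
      have hm2 : m.choose 1 ≤ m.choose 2 := by
        rw [Nat.choose_one_right]
        exact le_choose_of_mem_Ioo m 2 (by omega) (by omega)
      omega

/-! ### The profile bound without the top class -/

omit [DecidableEq α] in
/-- The top term of the telescoped sum is `(1 − τ)/(n − j − 1)` (`1 ≤ j`, `2j + 1 ≤ n`). -/
theorem top_term_eq {j : ℕ} (hj : 1 ≤ j) (hn : 2 * j + 1 ≤ Fintype.card α) :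
    tauQ α j * (cumCount (Fintype.card α) j (j - 1) : ℚ) /
        (((Fintype.card α : ℚ) - 2 * j + (j - 1 : ℕ)) * ((Fintype.card α : ℚ) - 2 * j + (j - 1 : ℕ) + 1)) =
      (1 - tauQ α j) / ((Fintype.card α : ℚ) - j - 1) := by
  have hjn : j < Fintype.card α := by omega
  have hcum : (cumCount (Fintype.card α) j (j - 1) : ℚ) =
      ((Fintype.card α).choose (j + 1) : ℚ) - ((Fintype.card α : ℚ) - j) := by
    rw [← sum_classCount_lt hjn]
    unfold cumCount
    rw [show j - 1 + 1 = j by omega]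
    push_cast
    rfl
  have hτ := tauQ_mul_choose (α := α) hjn
  have hc : ((j - 1 : ℕ) : ℚ) = (j : ℚ) - 1 := by
    rw [Nat.cast_sub hj]
    push_cast
    ring
  have hN1 : ((Fintype.card α : ℚ) - j - 1) ≠ 0 := by
    have : (j + 1 : ℚ) < Fintype.card α := by
      have : j + 1 < Fintype.card α := by omega
      exact_mod_cast this
    linarith
  have hN : ((Fintype.card α : ℚ) - j) ≠ 0 := by
    have : (j : ℚ) < Fintype.card α := by exact_mod_cast hjn
    linarith
  rw [hcum, hc]
  have e1 : ((Fintype.card α : ℚ) - 2 * j + ((j : ℚ) - 1)) = (Fintype.card α : ℚ) - j - 1 := by ring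
  rw [e1]
  have e2 : ((Fintype.card α : ℚ) - j - 1 + 1) = (Fintype.card α : ℚ) - j := by ring
  rw [e2, div_eq_div_iff (mul_ne_zero hN1 hN) hN1]
  linear_combination ((Fintype.card α : ℚ) - j - 1) * hτ

/-- **The profile bound without the top class**: if no word of `D` is near the `j`-set `X ∉ D`, then
`Σ_B e(#(X ∩ B)) ≤ j/(n − j + 1) − (1 − τ)/(n − j − 1)` (`1 ≤ j`, `2j + 1 ≤ n`). -/
theorem sum_eDef_le_of_no_near {j : ℕ} {D : Finset (Finset α)} (hD : IsCode j D) (hj : 1 ≤ j)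
    (hn : 2 * j + 1 ≤ Fintype.card α) {X : Finset α} (hX : X.card = j) (hXD : X ∉ D)
    (hnear : ∀ B ∈ D, (X ∩ B).card + 1 ≠ j) :
    ∑ B ∈ D, eDef α j (X ∩ B).card ≤
      (j : ℚ) / ((Fintype.card α : ℚ) - j + 1) - (1 - tauQ α j) / ((Fintype.card α : ℚ) - j - 1) := by
  have hjn : j ≤ Fintype.card α := by omega
  have hmaps : ∀ B ∈ D, (X ∩ B).card ∈ range j := by
    intro B hB
    rw [mem_range]
    exact aOf_lt (hD.1 B hB) hX (fun h => hXD (h ▸ hB))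
  rw [← sum_fiberwise_of_maps_to hmaps]
  -- the fibre bound of PuncturedLYMProfileSum, class by class
  have hfib : ∀ a ∈ range j, ∑ B ∈ D.filter (fun B => (X ∩ B).card = a), eDef α j (X ∩ B).card ≤
      tauQ α j * (cumCount (Fintype.card α) j a : ℚ) /
        (((Fintype.card α : ℚ) - 2 * j + a) * ((Fintype.card α : ℚ) - 2 * j + a + 1)) := by
    intro a ha
    rw [mem_range] at ha
    have h1 : ∑ B ∈ D.filter (fun B => (X ∩ B).card = a), eDef α j (X ∩ B).card =
        ((D.filter (fun B => (X ∩ B).card = a)).card : ℚ) * eDef α j a := by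
      rw [← nsmul_eq_mul, ← sum_const]
      apply sum_congr rfl
      intro B hB
      rw [(mem_filter.1 hB).2]
    rw [h1, ← eDef_mul_eq ha hn]
    apply mul_le_mul_of_nonneg_right _ (eDef_nonneg ha.le hjn)
    have hpack := card_profile_mul_le hD hX ha
    rw [card_midSets hX (by omega)] at hpack
    have hja : (0 : ℚ) < (j : ℚ) - a := by
      have : (a : ℚ) < j := by exact_mod_cast ha
      linarith
    rw [le_div_iff₀ hja]
    have : (((D.filter (fun B => (X ∩ B).card = a)).card * (j - a) : ℕ) : ℚ) ≤
        ((j.choose a * (Fintype.card α - j).choose (j - 1 - a) : ℕ) : ℚ) := by exact_mod_cast hpack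
    push_cast [Nat.cast_sub ha.le] at this
    push_cast
    linarith
  -- the top fibre is empty
  have htop : ∑ B ∈ D.filter (fun B => (X ∩ B).card = j - 1), eDef α j (X ∩ B).card = 0 := by
    apply sum_eq_zero
    intro B hB
    rw [mem_filter] at hB
    exact absurd (by omega : (X ∩ B).card + 1 = j) (hnear B hB.1)
  -- split off the top class of the telescoped sum
  have hsplit := sum_tele_eq (α := α) hj hn
  rw [← Nat.sub_add_cancel hj, sum_range_succ] at hsplit
  rw [Nat.sub_add_cancel hj] at hsplit
  rw [top_term_eq hj hn] at hsplit
  obtain ⟨j', hj'⟩ : ∃ j', j = j' + 1 := ⟨j - 1, by omega⟩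
  have hsum : ∑ a ∈ range j, ∑ B ∈ D.filter (fun B => (X ∩ B).card = a), eDef α j (X ∩ B).card =
      ∑ a ∈ range (j - 1), ∑ B ∈ D.filter (fun B => (X ∩ B).card = a), eDef α j (X ∩ B).card := by
    rw [← Nat.sub_add_cancel hj, sum_range_succ, Nat.sub_add_cancel hj, htop, add_zero]
  rw [hsum]
  calc ∑ a ∈ range (j - 1), ∑ B ∈ D.filter (fun B => (X ∩ B).card = a), eDef α j (X ∩ B).card
      ≤ ∑ a ∈ range (j - 1), tauQ α j * (cumCount (Fintype.card α) j a : ℚ) /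
          (((Fintype.card α : ℚ) - 2 * j + a) * ((Fintype.card α : ℚ) - 2 * j + a + 1)) := by
        apply sum_le_sum
        intro a ha
        exact hfib a (mem_range.2 (by have := mem_range.1 ha; omega))
    _ = (j : ℚ) / ((Fintype.card α : ℚ) - j + 1) - (1 - tauQ α j) / ((Fintype.card α : ℚ) - j - 1) := by
        linarith

/-! ### Theorem A at `n = 3j − 2` -/

omit [DecidableEq α] in
/-- `τ·(2j − 1) ≤ 2` when `n = 3j − 2`, `j ≥ 3`. -/
theorem tauQ_mul_le_two {j : ℕ} (hj : 3 ≤ j) (hn : Fintype.card α + 2 = 3 * j) :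
    tauQ α j * (2 * (j : ℚ) - 1) ≤ 2 := by
  have hjn : j < Fintype.card α := by omega
  have hτ := tauQ_mul_choose (α := α) hjn
  have hYpos : (0 : ℚ) < ((Fintype.card α).choose (j + 1) : ℚ) := by
    have : 0 < (Fintype.card α).choose (j + 1) := Nat.choose_pos hjn
    exact_mod_cast this
  -- `C(n, j+1) ≥ C(n, 2) = n(n−1)/2`
  have h2 : (Fintype.card α).choose 2 ≤ (Fintype.card α).choose (j + 1) :=
    choose_two_le_choose (Fintype.card α) (j + 1) (by omega) (by omega)
  have hC2 : ((Fintype.card α).choose 2 : ℚ) * 2 = (Fintype.card α : ℚ) * ((Fintype.card α : ℚ) - 1) := by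
    have := Nat.choose_two_right (Fintype.card α)
    have h' : (((Fintype.card α).choose 2 * 2 : ℕ) : ℚ) = ((Fintype.card α * (Fintype.card α - 1) : ℕ) : ℚ) := by
      rw [this, Nat.div_mul_cancel (Nat.even_mul_pred_self _).two_dvd]
    push_cast [Nat.cast_sub (by omega : 1 ≤ Fintype.card α)] at h'
    linarith
  have h2q : ((Fintype.card α).choose 2 : ℚ) ≤ ((Fintype.card α).choose (j + 1) : ℚ) := by exact_mod_cast h2
  have hnq : (Fintype.card α : ℚ) + 2 = 3 * j := by exact_mod_cast hn
  -- `τ = (n − j)/C(n, j+1)`; `(n−j)(2j−1) ≤ 2·C(n, j+1)` since `2·C(n,2) = n(n−1) ≥ (n−j)(2j−1)` at `n = 3j − 2`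
  unfold tauQ
  rw [div_mul_eq_mul_div, div_le_iff₀ hYpos]
  have hj3 : (3 : ℚ) ≤ j := by exact_mod_cast hj
  nlinarith [h2q, hC2, hnq, hj3]

/-- **THEOREM A, SHARP: (SP) holds for every code with `3 ≤ j`, `2j + 1 ≤ n` and `3j ≤ n + 2`.** -/
theorem puncturedNMP_of_three_j' {j : ℕ} {D : Finset (Finset α)} (hD : IsCode j D) (hj : 3 ≤ j)
    (hn : 2 * j + 1 ≤ Fintype.card α) (h3 : 3 * j ≤ Fintype.card α + 2) : PuncturedNMP j D := by
  rcases Nat.lt_or_ge (Fintype.card α + 1) (3 * j) with hlt | hge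
  swap
  · exact puncturedNMP_of_three_j hD (by omega) hn hge
  have hn3 : Fintype.card α + 2 = 3 * j := by omega
  have hjn : j < Fintype.card α := by omega
  have hj0 : 0 < j := by omega
  have hj1 : 1 ≤ j := by omega
  have hn2 : 2 * j ≤ Fintype.card α := by omega
  have hnj : (0 : ℚ) < (Fintype.card α : ℚ) - j := by
    have : (j : ℚ) < Fintype.card α := by exact_mod_cast hjn
    linarith
  have hnj1 : (0 : ℚ) < (Fintype.card α : ℚ) - j - 1 := by
    have : (j + 1 : ℚ) < Fintype.card α := by
      have : j + 1 < Fintype.card α := by omega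
      exact_mod_cast this
    linarith
  have hnj1' : (0 : ℚ) < (Fintype.card α : ℚ) - j + 1 := by linarith
  -- the sharper error bound
  set M : ℚ := ((j : ℚ) / ((Fintype.card α : ℚ) - j + 1) - (1 - tauQ α j) / ((Fintype.card α : ℚ) - j - 1)) /
    ((Fintype.card α : ℚ) - j) with hM_def
  have hτ1 : tauQ α j ≤ 1 := by
    have h := tauQ_mul_choose (α := α) hjn
    have hYpos : (0 : ℚ) < ((Fintype.card α).choose (j + 1) : ℚ) := by
      have : 0 < (Fintype.card α).choose (j + 1) := Nat.choose_pos hjn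
      exact_mod_cast this
    have hge : (Fintype.card α : ℚ) - j ≤ ((Fintype.card α).choose (j + 1) : ℚ) := by
      have h1 := le_choose_of_mem_Ioo (Fintype.card α) (j + 1) (by omega) (by omega)
      have h1q : (Fintype.card α : ℚ) ≤ ((Fintype.card α).choose (j + 1) : ℚ) := by exact_mod_cast h1
      have : (0 : ℚ) ≤ j := by positivity
      linarith
    unfold tauQ
    rw [div_le_one hYpos]
    exact hge
  have hM0 : 0 ≤ M := by
    rw [hM_def]
    apply div_nonneg _ hnj.le
    -- `j/(n−j+1) ≥ (1−τ)/(n−j−1)` since `j(n−j−1) ≥ (n−j+1)` for `j ≥ 3`, `n ≥ 2j+1`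
    rw [sub_nonneg, div_le_div_iff₀ hnj1 hnj1']
    have hjq : (3 : ℚ) ≤ j := by exact_mod_cast hj
    have hnq : (2 * j + 1 : ℚ) ≤ Fintype.card α := by exact_mod_cast hn
    have hτ0 := tauQ_nonneg (α := α) (j := j) hjn.le
    nlinarith
  have hM : ∀ B ∈ D, ∀ y' ∉ B, max (errE α j D B y') 0 ≤ M := by
    intro B hB y' _
    calc max (errE α j D B y') 0
        ≤ (∑ B' ∈ D.erase B, eDef α j (B ∩ B').card) / ((Fintype.card α : ℚ) - j) := max_errE_le hD hn2 hjn hB y'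
      _ ≤ M := by
          rw [hM_def]
          apply div_le_div_of_nonneg_right _ hnj.le
          apply sum_eDef_le_of_no_near (isCode_erase hD B) hj1 hn (hD.1 B hB) (notMem_erase B D)
          intro B' hB'
          have hne : B ≠ B' := (ne_of_mem_erase hB').symm
          have := hD.2 B hB B' (mem_of_mem_erase hB') hne
          omega
  set c : ℚ := ((punctured j D).card : ℚ) / (levelAbove α j).card with hc_def
  have hc0 : 0 ≤ c := by positivity
  refine puncturedNMP_of_weights (fun X Y => totalWp α j D X Y / c) ?_ ?_ ?_
  · intro X hX Y hY
    obtain ⟨hXc, hXD⟩ := mem_punctured.1 hX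
    rw [sups_eq hXc] at hY
    obtain ⟨y, hy, rfl⟩ := mem_image.1 hY
    rw [totalWp_insert j D X (mem_sdiff.1 hy).2]
    apply div_nonneg _ hc0
    have h1 := superW_ge hD hn2 hjn X y
    have h2 := sum_reroute_ge hD hjn hM0 hM hXc (mem_sdiff.1 hy).2
    have hN := sum_eDef_le hD hj1 hn hXc hXD
    unfold totalW
    -- `(1 − N)/(n−j) − M ≥ (1 − 2j/(n−j+1) + (1−τ)/(n−j−1))/(n−j) ≥ 0`
    have hkey : 0 ≤ (1 - ∑ B ∈ D, eDef α j (X ∩ B).card) / ((Fintype.card α : ℚ) - j) - M := by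
      rw [hM_def, ← sub_div]
      apply div_nonneg _ hnj.le
      have hτ2 := tauQ_mul_le_two hj hn3
      have hnq : (Fintype.card α : ℚ) + 2 = 3 * j := by exact_mod_cast hn3
      have hjq : (3 : ℚ) ≤ j := by exact_mod_cast hj
      -- at `n = 3j − 2`: `n − j + 1 = 2j − 1`, `n − j − 1 = 2j − 3`
      have e1 : (Fintype.card α : ℚ) - j + 1 = 2 * j - 1 := by linarith
      have e2 : (Fintype.card α : ℚ) - j - 1 = 2 * j - 3 := by linarith
      rw [e1, e2]
      rw [e1] at hN
      have h21 : (0 : ℚ) < 2 * j - 1 := by linarith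
      have h23 : (0 : ℚ) < 2 * j - 3 := by linarith
      have hfrac : 2 * (j : ℚ) / (2 * j - 1) - (1 - tauQ α j) / (2 * j - 3) ≤ 1 := by
        rw [div_sub_div _ _ h21.ne' h23.ne', div_le_one (mul_pos h21 h23)]
        nlinarith [hτ2]
      have h2j : 2 * (j : ℚ) / (2 * j - 1) = (j : ℚ) / (2 * j - 1) + (j : ℚ) / (2 * j - 1) := by ring
      linarith
    linarith
  · intro X hX
    rw [← sum_div, sum_sups_totalWp hD hjn hX, hc_def, one_div_div]
  · intro Y hY
    rw [← sum_div, sum_subsP_totalWp hD hj0 hjn (mem_levelAbove.1 hY), ← hc_def]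
    rcases eq_or_ne c 0 with hc | hc
    · rw [hc, div_zero]
      exact zero_le_one
    · rw [div_self hc]

omit [Fintype α] in
/-- Theorem A, sharp, inside any finset `E`. -/
theorem puncturedNMP_in_of_three_j' {E : Finset α} {j : ℕ} {D : Finset (Finset α)} (hD : IsCodeIn j E D)
    (hj : 3 ≤ j) (hn : 2 * j + 1 ≤ E.card) (h3 : 3 * j ≤ E.card + 2) : PuncturedNMPIn j E D := by
  apply puncturedNMP_in_of_subtype hD
  apply puncturedNMP_of_three_j' (isCode_image_toSub hD) hj
  · rw [Fintype.card_coe]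
    exact hn
  · rw [Fintype.card_coe]
    exact h3

end PercRepro.PuncturedLYM

namespace PercRepro.Cogirth

open Finset ThmH Skew

variable {α : Type} [DecidableEq α] {M : Matroid α} [M.Finite]

/-- **(NC) for every sparse paving matroid with `r + 1 ≤ n`, `n + 2 ≤ 2r`, `3 ≤ n − r` and `3(n − r) ≤ n + 2`**
(Theorem A, sharp, at the bottom level). -/
theorem normConsAt_of_sparsePaving'' {r : ℕ} (hsp : IsSparsePavingF M r) (hr1 : r + 1 ≤ (gr M).card)
    (hn : (gr M).card + 2 ≤ 2 * r) (hj : 3 ≤ (gr M).card - r) (h3 : 3 * ((gr M).card - r) ≤ (gr M).card + 2) :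
    NormConsAt M := by
  intro U hU j
  have hr : r ≤ (gr M).card := by omega
  rcases Nat.lt_or_ge j ((gr M).card - r) with hlt | hge
  · apply normConsStep_of_lt
    rw [hsp.1]
    omega
  rcases Nat.eq_or_lt_of_le hge with heq | hgt
  · rw [← heq]
    apply normConsStep_bottom_of_puncturedNMPIn hsp hn hU
    exact PuncturedLYM.puncturedNMP_in_of_three_j' (isCodeIn_cocode hsp hr) hj (by omega) (by omega)
  rcases Nat.lt_or_ge (j + 1) r with hmid | htop
  · apply normConsStep_of_indep_succ_of_indep_sdiff hU (by omega)
    · intro S hS hSc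
      exact rk_eq_card_of_card_lt_of_sparsePaving hsp hr hS (by omega)
    · intro S hS hSc
      exact rk_eq_card_of_card_lt_of_sparsePaving hsp hr hS (by omega)
  · apply normConsStep_of_rk_le hU
    rw [hsp.1]
    omega

end PercRepro.Cogirth
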